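import Summits.NavierStokesRegularity.NavierStokesRegularity.Theorems.CoriolisHeadLocalEnergyDensitySlices
import HarnessLib

/-!
# CoriolisHeadLocalEnergyDensityStep — crux `NoCoRotatingCore` (stmt-NavierStokesRegularity-22676), line
# `local_energy_rescue` (crux workfile, ns-idea-10 g3), stub S2 `stub_densityBootstrap` — file 2: the one-step local
# energy inequality in similarity variables

`LocalEnergyRescue.energy_step`: for a smooth bounded Pineau–Vicol profile `(V, Q)` (`u = pvAnsatz α V` is a classical
Navier–Stokes solution on `(−∞, 0)`, tree `isClassicalNSSolutionOn_pvAnsatz_of_profile`), a local energy bound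
`∫_{B(z,ρ)}‖V‖² ≤ Aρⁿ` (`ρ ≥ 1`) and a gauged pressure-flux bound `∫_{B(z,ρ)}|Q − m|‖V‖ ≤ J(ρ)` give, for every centre
`z` and every top time `t₁ ∈ [−1, 0)`,
`√(−t₁) ∫_{B(z, 1/√(−t₁))} ‖V‖² ≤ B A Rⁿ + ∫_{−1}^{t₁} [B√(−s)A(R/√(−s))ⁿ + B M A(R/√(−s))ⁿ + 2B J(R/√(−s))] ds`:
the PHYSICAL local energy identity with the dissipation dropped (tree
`IsClassicalNSSolutionOn.integral_cutoff_norm_sq_sub_le`) against a TIME-INDEPENDENT translated bump `φ₀(· − x₀)`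
(`exists_cutoff_data`, from the tree's `exists_unit_bump` / `exists_testFunction_translate_bounds`), each slice of the flux
read in similarity variables (`flux_slice_le` of file 1).  This is the mechanism of the line card's S2 (the fixed
physical ball is a ball of radius `R/√(−s)` around a moving centre in similarity variables; the similarity-variables
identity with a fixed cut-off would instead see the drift across the ball).

HONEST FRAMING.  Helper for an unregistered line's stub; nothing here proves `NoCoRotatingCore` or NS regularity.

References: D. Chae, J. Wolf, arXiv:1610.09464, §2 Step 2 (2.4c)–(2.4f) [ChaeWolf2017RemovingDSS]; L. Caffarelli, R. Kohn,
L. Nirenberg, CPAM 35 (1982) §2 (2.5) [CaffarelliKohnNirenberg1982]; line card `Lines/local_energy_rescue.md` (S2).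
-/

noncomputable section

open MeasureTheory Set Function Filter Topology Metric InnerProductSpace Real
open scoped RealInnerProductSpace Laplacian ContDiff Topology

-- the summit and its single sub-problem share the name (CONVENTIONS §1), as in every Theorems file
set_option linter.dupNamespace false

namespace Summit.NavierStokesRegularity.NavierStokesRegularity.Theorems.CoriolisHead

namespace LocalEnergyRescue

open Literature.Analysis.FluidPDE

/-! ## §6 The cut-off and the one-step energy inequality in similarity variables -/

/-- **A translated unit bump with uniform bounds**: `φ₀ ∈ C_c^∞`, `0 ≤ φ₀`, `φ₀ = 1` on `B(0,1)`, and constants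
`R ≥ 1`, `B ≥ 0` such that every translate `φ₀(· − x₀)` has `|φ|, ‖Dφ‖, |Δφ| ≤ B` and `Dφ`, `Δφ`, `φ` vanish off
`B(x₀, R)` (tree `exists_unit_bump`, `exists_testFunction_translate_bounds`). [folklore] -/
theorem exists_cutoff_data :
    ∃ (φ₀ : EuclideanSpace ℝ (Fin 3) → ℝ) (R B : ℝ), 1 ≤ R ∧ 0 ≤ B ∧
      ContDiff ℝ ∞ φ₀ ∧ HasCompactSupport φ₀ ∧ (∀ x, 0 ≤ φ₀ x) ∧
      (∀ x ∈ ball (0 : EuclideanSpace ℝ (Fin 3)) 1, φ₀ x = 1) ∧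
      ∀ x₀ x : EuclideanSpace ℝ (Fin 3),
        |φ₀ (x - x₀)| ≤ B ∧ ‖fderiv ℝ (fun y => φ₀ (y - x₀)) x‖ ≤ B ∧
        |(Δ fun y => φ₀ (y - x₀)) x| ≤ B ∧
        (x ∉ ball x₀ R → φ₀ (x - x₀) = 0 ∧ fderiv ℝ (fun y => φ₀ (y - x₀)) x = 0 ∧
          (Δ fun y => φ₀ (y - x₀)) x = 0) := by
  obtain ⟨φ₀, hφ₀, hnn, hone⟩ := exists_unit_bump
  obtain ⟨R, B, hR, hB, hbd⟩ := exists_testFunction_translate_bounds hφ₀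
  have hgrad : ∀ (f : EuclideanSpace ℝ (Fin 3) → ℝ) (x : EuclideanSpace ℝ (Fin 3)),
      ‖fderiv ℝ f x‖ = ‖gradient f x‖ := fun f x => by
    unfold gradient
    exact ((InnerProductSpace.toDual ℝ (EuclideanSpace ℝ (Fin 3))).symm.norm_map _).symm
  refine ⟨φ₀, max R 1, B, le_max_right _ _, hB, hφ₀.contDiff, hφ₀.hasCompactSupport, hnn, hone,
    fun x₀ x => ⟨(hbd x₀ x).1, ?_, (hbd x₀ x).2.2.1, fun hx => ?_⟩⟩
  · rw [hgrad]; exact (hbd x₀ x).2.1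
  · have hx' : x ∉ ball x₀ R := fun h => hx (ball_subset_ball (le_max_left _ _) h)
    obtain ⟨h1, h2, h3⟩ := (hbd x₀ x).2.2.2 hx'
    refine ⟨h1, ?_, h3⟩
    have h := hgrad (fun y => φ₀ (y - x₀)) x
    rw [h2, norm_zero] at h
    exact norm_eq_zero.1 h

section Master

variable {α : ℝ} {V : EuclideanSpace ℝ (Fin 3) → EuclideanSpace ℝ (Fin 3)}
  {Q : EuclideanSpace ℝ (Fin 3) → ℝ}

/-- Going back to the physical centre: `c⁻¹ • R_{−θ} (c • R_θ z) = z`. [folklore] -/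
theorem inv_smul_rotZ_neg_center {c : ℝ} (hc : c ≠ 0) (θ : ℝ) (z : EuclideanSpace ℝ (Fin 3)) :
    c⁻¹ • rotZ (-θ) (c • rotZ θ z) = z := by
  have h := smul_rotZ_center (inv_ne_zero hc) (-θ) z
  rwa [inv_inv, neg_neg] at h

/-- **The one-step local energy inequality in similarity variables.**  For a smooth bounded Pineau–Vicol
profile `(V, Q)` with a local energy bound `∫_{B(z,ρ)}‖V‖² ≤ Aρⁿ` (`ρ ≥ 1`) and a gauged pressure-flux bound
`∫_{B(z,ρ)}|Q − m|‖V‖ ≤ J(ρ)` (`ρ ≥ 1`, some gauge `m`), there are cut-off constants `R ≥ 1`, `B ≥ 0` such that for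
every centre `z` and every `t₁ ∈ [−1, 0)`:
`√(−t₁) ∫_{B(z, 1/√(−t₁))} ‖V‖² ≤ B A Rⁿ + ∫_{−1}^{t₁} [B√(−s)A(R/√(−s))ⁿ + B M A(R/√(−s))ⁿ + 2B J(R/√(−s))] ds`
— the physical local energy identity (`IsClassicalNSSolutionOn.integral_cutoff_norm_sq_sub_le`) for
`u = pvAnsatz α V` against the cut-off `φ₀(· − x₀)`, `x₀ = √(−t₁)R_{θ₁} z`, read slice by slice in similarity
variables (`flux_slice_le`). [cite: ChaeWolf2017RemovingDSS, §2 Step 2 (2.4f) (arXiv p. 5)] -/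
theorem energy_step (hV : ContDiff ℝ ∞ V) (hQ : ContDiff ℝ ∞ Q) (hdiv : VectorCalculus.IsDivFree V)
    (heq : ∀ y : EuclideanSpace ℝ (Fin 3), α • (rotGen (V y) - fderiv ℝ V y (rotGen y)) +
      (1 / 2 : ℝ) • V y + (1 / 2 : ℝ) • fderiv ℝ V y y - (Δ V) y + fderiv ℝ V y (V y) +
      gradient Q y = 0)
    {M : ℝ} (hM : ∀ y, ‖V y‖ ≤ M) {A : ℝ} {n : ℕ}
    (hI : ∀ (z : EuclideanSpace ℝ (Fin 3)) (ρ : ℝ), 1 ≤ ρ → ∫ y in ball z ρ, ‖V y‖ ^ 2 ≤ A * ρ ^ n)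
    {J : ℝ → ℝ} (hJc : Continuous J)
    (hJ : ∀ (z : EuclideanSpace ℝ (Fin 3)) (ρ : ℝ), 1 ≤ ρ →
      ∃ m : ℝ, ∫ y in ball z ρ, |Q y - m| * ‖V y‖ ≤ J ρ) :
    ∃ R B : ℝ, 1 ≤ R ∧ 0 ≤ B ∧ ∀ (z : EuclideanSpace ℝ (Fin 3)) (t₁ : ℝ), -1 ≤ t₁ → t₁ < 0 →
      Real.sqrt (-t₁) * ∫ y in ball z (1 / Real.sqrt (-t₁)), ‖V y‖ ^ 2 ≤
        B * (A * R ^ n) + ∫ s in (-1 : ℝ)..t₁, (B * (Real.sqrt (-s) * (A * (R / Real.sqrt (-s)) ^ n)) +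
          B * (M * (A * (R / Real.sqrt (-s)) ^ n)) + 2 * B * J (R / Real.sqrt (-s))) := by
  obtain ⟨φ₀, R, B, hR1, hB0, hφ₀, hφ₀c, hφ₀nn, hφ₀one, hbd⟩ := exists_cutoff_data
  have hM0 : 0 ≤ M := (norm_nonneg _).trans (hM 0)
  refine ⟨R, B, hR1, hB0, fun z t₁ ht₁ ht₁0 => ?_⟩
  have hNS : IsClassicalNSSolutionOn (Iio 0) 1 0 (pvAnsatz α (fun y _ => V y))
      (ofLerayOrbitPressure (fun (s : ℝ) (y : EuclideanSpace ℝ (Fin 3)) => Q (rotZ (-(α * s)) y))) :=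
    isClassicalNSSolutionOn_pvAnsatz_of_profile (α := α) hV hQ hdiv heq
  -- the physical centre
  set c₁ : ℝ := Real.sqrt (-t₁) with hc₁
  have hc₁pos : 0 < c₁ := Real.sqrt_pos.2 (by linarith)
  set θ₁ : ℝ := α * -Real.log (-t₁) with hθ₁
  set x₀ : EuclideanSpace ℝ (Fin 3) := c₁ • rotZ θ₁ z with hx₀
  have hz : c₁⁻¹ • rotZ (-θ₁) x₀ = z := inv_smul_rotZ_neg_center hc₁pos.ne' θ₁ z
  -- the translated cut-off
  set φ : EuclideanSpace ℝ (Fin 3) → ℝ := fun x => φ₀ (x - x₀) with hφdef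
  have hφtest := isTestFunctionOn_comp_sub_right ⟨hφ₀, hφ₀c, by simp⟩ x₀
  have hφ : ContDiff ℝ ∞ φ := hφtest.contDiff
  have hφc : HasCompactSupport φ := hφtest.hasCompactSupport
  have hφ0 : ∀ x, 0 ≤ φ x := fun x => hφ₀nn _
  have hφ1 : ∀ x ∈ ball x₀ 1, φ x = 1 := fun x hx => by
    refine hφ₀one _ ?_
    rwa [mem_ball_zero_iff, ← dist_eq_norm, ← mem_ball]
  -- the energy inequality (dissipation dropped)
  have hIcc : Icc (-1 : ℝ) t₁ ⊆ Iio 0 := fun s hs => lt_of_le_of_lt hs.2 ht₁0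
  have hE := hNS.integral_cutoff_norm_sq_sub_le isOpen_Iio zero_le_one hφ hφc hφ0 ht₁ hIcc
  -- bottom: the energy at `t₁` dominates the profile energy on `B(z, 1/c₁)`
  have hbot := sqrt_mul_setIntegral_le_integral_cutoff (α := α) hV hQ hdiv heq hφ.continuous hφc hφ0 hφ1
    ht₁0
  rw [← hc₁, ← hθ₁, hz] at hbot
  -- top: the energy at `-1`
  have htop := integral_cutoff_neg_one_le (α := α) hV hQ hdiv heq hφ.continuous hφc
    (fun x => (hbd x₀ x).1) (fun x hx => ((hbd x₀ x).2.2.2 hx).1)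
  have htop' : ∫ x, φ x * ‖pvAnsatz α (fun y _ => V y) (-1) x‖ ^ 2 ≤ B * (A * R ^ n) :=
    htop.trans (mul_le_mul_of_nonneg_left (hI _ R hR1) hB0)
  -- the flux, slice by slice
  have hflux : ∀ s ∈ Icc (-1 : ℝ) t₁,
      (∫ x, ((1 : ℝ) * ((Δ φ) x * ‖pvAnsatz α (fun y _ => V y) s x‖ ^ 2) +
        fderiv ℝ φ x (pvAnsatz α (fun y _ => V y) s x) * ‖pvAnsatz α (fun y _ => V y) s x‖ ^ 2 +
        2 * (ofLerayOrbitPressure (fun (s : ℝ) (y : EuclideanSpace ℝ (Fin 3)) => Q (rotZ (-(α * s)) y)) s x *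
          fderiv ℝ φ x (pvAnsatz α (fun y _ => V y) s x)))) ≤
      B * (Real.sqrt (-s) * (A * (R / Real.sqrt (-s)) ^ n)) + B * (M * (A * (R / Real.sqrt (-s)) ^ n)) +
        2 * B * J (R / Real.sqrt (-s)) := by
    intro s hs
    have hs0 : s < 0 := hIcc hs
    have hcs : 0 < Real.sqrt (-s) := Real.sqrt_pos.2 (by linarith)
    have hcs1 : Real.sqrt (-s) ≤ 1 := by
      rw [show (1 : ℝ) = Real.sqrt 1 by simp]
      exact Real.sqrt_le_sqrt (by linarith [hs.1])
    set zs : EuclideanSpace ℝ (Fin 3) := (Real.sqrt (-s))⁻¹ • rotZ (-(α * -Real.log (-s))) x₀ with hzs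
    set ρs : ℝ := R / Real.sqrt (-s) with hρs
    have hρs1 : 1 ≤ ρs := by
      rw [hρs, le_div_iff₀ hcs]; nlinarith
    obtain ⟨m, hm⟩ := hJ zs ρs hρs1
    have h := flux_slice_le (α := α) hV hQ hdiv heq hφ hφc (x₀ := x₀) (R := R) (B := B)
      (fun x => (hbd x₀ x).2.1) (fun x => (hbd x₀ x).2.2.1) (fun x hx => ((hbd x₀ x).2.2.2 hx).2.1)
      (fun x hx => ((hbd x₀ x).2.2.2 hx).2.2) hs0 m
    rw [← hzs, ← hρs] at h
    -- the three profile integrals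
    have hI2 : ∫ y in ball zs ρs, ‖V y‖ ^ 2 ≤ A * ρs ^ n := hI zs ρs hρs1
    have hI3 : ∫ y in ball zs ρs, ‖V y‖ ^ 3 ≤ M * (A * ρs ^ n) := by
      have hV3 : IntegrableOn (fun y => ‖V y‖ ^ 3) (ball zs ρs) volume :=
        ((hV.continuous.norm.pow 3).continuousOn.integrableOn_compact (isCompact_closedBall zs ρs)).mono_set
          ball_subset_closedBall
      have hV2 : IntegrableOn (fun y => M * ‖V y‖ ^ 2) (ball zs ρs) volume :=
        (((hV.continuous.norm.pow 2).continuousOn.integrableOn_compact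
          (isCompact_closedBall zs ρs)).mono_set ball_subset_closedBall).const_mul M
      calc ∫ y in ball zs ρs, ‖V y‖ ^ 3 ≤ ∫ y in ball zs ρs, M * ‖V y‖ ^ 2 := by
            refine setIntegral_mono_on hV3 hV2 measurableSet_ball fun y _ => ?_
            have e : ‖V y‖ ^ 3 = ‖V y‖ * ‖V y‖ ^ 2 := by ring
            rw [e]
            exact mul_le_mul_of_nonneg_right (hM y) (by positivity)
        _ = M * ∫ y in ball zs ρs, ‖V y‖ ^ 2 := integral_const_mul _ _
        _ ≤ M * (A * ρs ^ n) := mul_le_mul_of_nonneg_left hI2 hM0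
    have hI20 : 0 ≤ ∫ y in ball zs ρs, ‖V y‖ ^ 2 := setIntegral_nonneg measurableSet_ball fun y _ => by
      positivity
    refine h.trans ?_
    have t1 : B * (Real.sqrt (-s) * ∫ y in ball zs ρs, ‖V y‖ ^ 2) ≤
        B * (Real.sqrt (-s) * (A * ρs ^ n)) :=
      mul_le_mul_of_nonneg_left (mul_le_mul_of_nonneg_left hI2 hcs.le) hB0
    have t2 : B * (∫ y in ball zs ρs, ‖V y‖ ^ 3) ≤ B * (M * (A * ρs ^ n)) :=
      mul_le_mul_of_nonneg_left hI3 hB0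
    have t3 : 2 * B * (∫ y in ball zs ρs, |Q y - m| * ‖V y‖) ≤ 2 * B * J ρs :=
      mul_le_mul_of_nonneg_left hm (by positivity)
    linarith
  -- integrate the flux bound in time
  have hcontF := hNS.continuousOn_integral_flux_cutoff hφ hφc
  have hFint : IntervalIntegrable (fun s => ∫ x, ((1 : ℝ) * ((Δ φ) x * ‖pvAnsatz α (fun y _ => V y) s x‖ ^ 2) +
        fderiv ℝ φ x (pvAnsatz α (fun y _ => V y) s x) * ‖pvAnsatz α (fun y _ => V y) s x‖ ^ 2 +
        2 * (ofLerayOrbitPressure (fun (s : ℝ) (y : EuclideanSpace ℝ (Fin 3)) => Q (rotZ (-(α * s)) y)) s x *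
          fderiv ℝ φ x (pvAnsatz α (fun y _ => V y) s x)))) volume (-1) t₁ :=
    (hcontF.mono (by rwa [uIcc_of_le ht₁])).intervalIntegrable
  have hgcont : ContinuousOn (fun s : ℝ => B * (Real.sqrt (-s) * (A * (R / Real.sqrt (-s)) ^ n)) +
      B * (M * (A * (R / Real.sqrt (-s)) ^ n)) + 2 * B * J (R / Real.sqrt (-s))) (uIcc (-1) t₁) := by
    rw [uIcc_of_le ht₁]
    have hsq : ContinuousOn (fun s : ℝ => Real.sqrt (-s)) (Icc (-1) t₁) :=
      (Real.continuous_sqrt.comp continuous_neg).continuousOn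
    have hne : ∀ s ∈ Icc (-1 : ℝ) t₁, Real.sqrt (-s) ≠ 0 := fun s hs =>
      (Real.sqrt_pos.2 (by linarith [mem_Iio.1 (hIcc hs)])).ne'
    have hdiv : ContinuousOn (fun s : ℝ => R / Real.sqrt (-s)) (Icc (-1) t₁) :=
      continuousOn_const.div hsq hne
    have hJ' : ContinuousOn (fun s : ℝ => J (R / Real.sqrt (-s))) (Icc (-1) t₁) :=
      hJc.comp_continuousOn hdiv
    exact ((continuousOn_const.mul (hsq.mul (continuousOn_const.mul (hdiv.pow n)))).add
      (continuousOn_const.mul (continuousOn_const.mul (continuousOn_const.mul (hdiv.pow n))))).add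
      (continuousOn_const.mul hJ')
  have hgint := hgcont.intervalIntegrable (μ := volume)
  have hmono := intervalIntegral.integral_mono_on ht₁ hFint hgint hflux
  linarith [hbot, htop', hE, hmono]

end Master

end LocalEnergyRescue

end Summit.NavierStokesRegularity.NavierStokesRegularity.Theorems.CoriolisHead

end
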